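import Summits.BirchSwinnertonDyer.BirchSwinnertonDyer.Theorems.ThetaPartnerAtTwoSignedKatoUpToAtTwoInvolFunctionalEquation
import Literature.NumberTheory.EllipticCurves.PAdicLFunctionMinusMultFunctionalEquationProofs
import Literature.Barriers.BirchSwinnertonDyer.PAdicFunctionalEquationIdealFormProofs
import Literature.NumberTheory.EllipticCurves.PAdicLFunctionIntegralityAtTwoSplitMultProofs
import Literature.NumberTheory.EllipticCurves.PAdicLFunctionIntegralityAtTwoNonsplitMultProofs
import HarnessLib

/-!
# Route ByReductionTypeAtTwo, crux `AdditivePotMultOverKAtTwo` (stmt-BirchSwinnertonDyer-22618; parent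
# `AdditiveRankZeroAtTwo` 19098) — T20 (d) IN THE KERNEL, part 1: the functional equation of the ODD
# (`χ₋₄ ω^{i-1}`) branches of the `2`-adic `L`-function of a curve with MULTIPLICATIVE reduction at `2`, in
# `ℚ₂⟦T⟧` and in `Λ` (`(ι b) = (b)` for every integral multiple `b`), split and non-split

Cell `bsd-2adic` (run/shared/lean/pub/bsd-2adic/), seat `bsd-2adic-t42` GEN 21 (candidate AP3-R2 of the
pen's RC-368; audit-2 sheet `D-AUDIT-AP1AP3-…` 2026-08-29: flag «MTT86-§I.17-oddbranch-FE@2: READING»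
is struck by this kernel port — no acquisition of MTT §I.17 needed). HONEST FRAMING (HUMAN RULINGS
D-0036 / D-0054): theorems only — no definition, no named fact, no instance, no `sorry`; route-independent
(no `Theses` import); types-the-object-of (one displayed binder of T20 becomes a theorem); closes none;
nothing booked; BSD is not proved by any of this. PARTITION: X5@2 additive, the `(−1)`-split-twist block
of C4″ 22618 × p = 2.

## What is proved

The Literature file `PAdicLFunctionMinusMultFunctionalEquationProofs` (this seat) proves, for a rational
newform `f` of level `N = pM`, `p ∤ M`, `a_p(f) = ±1`, and every SELF-DUAL tame exponent `τ ∣ 2i`, the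
functional equation of Mazur–Tate–Teitelbaum 1986 §I.17 for the `ω^i`-branch of the ONE-term minus
measure (`ε(p) = 0`): `L⁻_p(f, a_p, ω^i, ι(T)) = w (1+T)^c L⁻_p(f, a_p, ω^i, T)`, `w = σ ω(−M)^i = ±1`
(`w_M f = −σ f`), `⟨M⟩ = γ^c`. At `p = 2` (`τ = 2`, `ω = χ₋₄`) EVERY `i` is self-dual. Here:

* §1 `exists_subst_padicLFunctionMinusBranchMult_two_eq_of_split` / `…_of_nonsplit` — for an elliptic
  `V/ℚ` split (resp. non-split) multiplicative at `2` and its newform `f ∈ S₂(Γ₀(N))` (ANY level; the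
  tree gives `2 ∣ N`, `4 ∤ N`, `a₂(f) = ±1`): `∃ w = ±1, c ∈ ℤ₂` with
  `L⁻_2(f, ±1, ω^i, ι(T)) = w (1+T)^c L⁻_2(f, ±1, ω^i, T)` for every `ι = (1+T)⁻¹ − 1`.
* §2 ideal forms: `span_singleton_subst_padicLFunctionMinusBranchMult_two_eq_of_split` (`ℚ₂⟦T⟧`) and
  the Λ-descent to integral multiples `IwasawaAlgebra.span_singleton_subst_eq_of_eq_oddBranchMult_two_of_split`
  / `…_of_nonsplit` (`(b(T^ι)) = (b)` in `Λ = ℤ₂⟦T⟧` whenever `b^ℚ = C t · L⁻_2(f, ±1, ω^i, T)`;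
  Burungale–Skinner descent `IwasawaAlgebra.span_singleton_subst_eq_of_iwasawaToPowerSeries_eq`).
* **T20 (d) discharged**: `map_invol_span_eq_of_eq_oddBranchMult_two_of_split` / `…_of_nonsplit` — in the
  EXACT currency of the addL2x doors (`AddKatoTwo.lengthAt_selmerDual_le_of_oddBranchInputs…`, p682028 /
  p682778 / p683557: binder `hLtι`): from `hsp`, `hf` and `hLt : Lt^ℚ = C t · padicLFunctionMinusBranchMult f 1 i`
  ALONE, `(Ideal.span {Lt}).map (IwasawaAlgebra.invol 2).toRingHom = Ideal.span {Lt}`. The re-glued door with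
  `hLtι` REMOVED is the sequel `ByReductionTypeAtTwoAdditiveOddBranchFEDoor.lean`.

References: [MazurTateTeitelbaum1986Invent] §I.10 (10.1), §I.13, §I.17; [GreenbergLNM1716] §1 pp. 67–68
("`f(T^ι)/f(T) ∈ Λ^×`"); [Knapp1993] Thm. 9.27(b); [BurungaleSkinner2023] Prop. 2.2 (descent to `Λ`);
[Kato2004Asterisque] Thm. 12.4, 12.5 (3), §17.13; memo `run/shared/lean/pub/bsd-2adic/t42/DESIGN-T42-ADDENDUM-25.md`.
-/

set_option autoImplicit false
-- the summit's namespace `Summit.BirchSwinnertonDyer.BirchSwinnertonDyer` (Sub = Summit) trips `dupNamespace`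
set_option linter.dupNamespace false

noncomputable section

open scoped Classical MatrixGroups ModularForm NumberField

open Field CongruenceSubgroup PowerSeries WeierstrassCurve IsDedekindDomain
  Literature.NumberTheory.EllipticCurves Literature.NumberTheory.EllipticCurves.ModularForms
  Literature.NumberTheory.EllipticCurves.Module Literature.Barriers.BirchSwinnertonDyer
  Summit.BirchSwinnertonDyer.BirchSwinnertonDyer.Theorems.SignedKatoOffTwo

namespace Summit.BirchSwinnertonDyer.BirchSwinnertonDyer.Theorems.MultOddBranchFE

/-! ## §1 The functional equation of the odd branches at a multiplicative `2` -/

section FE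

variable {V : WeierstrassCurve ℚ} {N : ℕ} [NeZero N] {f : CuspForm (Gamma0 N) 2}

omit [NeZero N] in
/-- The level of the newform of a curve multiplicative at `2` is `N = 2M` with `M` odd (`2 ∣ N`, `4 ∤ N`:
tree theorems `IsNewformOf.dvd_level_of_split` / `…_of_nonsplit`, `not_four_dvd_level_of_split` /
`…_of_nonsplit`, from `a₂(f) = ±1` and `a₄ = a₂²`). [folklore] -/
theorem level_eq_two_mul_of_dvd_of_not_four_dvd (h2 : 2 ∣ N) (h4 : ¬ 4 ∣ N) :
    N = 2 * (N / 2) ∧ ¬ 2 ∣ N / 2 := by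
  refine ⟨(Nat.mul_div_cancel' h2).symm, fun h ↦ h4 ?_⟩
  obtain ⟨k, hk⟩ := h
  have : N = 4 * k := by rw [← Nat.mul_div_cancel' h2, hk]; ring
  exact ⟨k, this⟩

/-- `τ = 2` at `p = 2`, so every tame exponent `i` is self-dual: `torsionOrder 2 ∣ 2 i`. [folklore] -/
theorem torsionOrder_two_dvd (i : ℕ) : torsionOrder 2 ∣ 2 * i := by
  rw [torsionOrder_eq, if_pos rfl]
  exact dvd_mul_right 2 i

/-- **FE of the odd branches at a SPLIT multiplicative `2`** (Mazur–Tate–Teitelbaum 1986, §I.17, via the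
tree's `exists_subst_padicLFunctionMinusBranchMult_eq`): for an elliptic `V/ℚ` split multiplicative at
`2` and its newform `f ∈ S₂(Γ₀(N))` (any level), and every `i`, there are `w = ±1 ∈ ℤ` and `c ∈ ℤ₂` with
`L⁻_2(f, 1, ω^i, ι(T)) = w · (1+T)^c · L⁻_2(f, 1, ω^i, T)` for every `ι` with `(1+T)(1+ι) = 1`
(`a₂(f) = 1`, `N = 2M`, `M` odd, `w = −λ_M(f)·χ₋₄(−M)^i`, `⟨M⟩ = 5^c`).
[cite: MazurTateTeitelbaum1986Invent, §I.17] [cite: Knapp1993, Thm. 9.27(b)] -/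
theorem exists_subst_padicLFunctionMinusBranchMult_two_eq_of_split
    (hsp : V.HasSplitMultiplicativeReductionAtPrime 2) (hf : IsNewformOf V f) (i : ℕ) :
    ∃ w : ℤ, w ^ 2 = 1 ∧ ∃ c : ℤ_[2], ∀ {ι : ℚ_[2]⟦X⟧}, (1 + X : ℚ_[2]⟦X⟧) * (ι + 1) = 1 →
      PowerSeries.subst ι (padicLFunctionMinusBranchMult f (1 : ℚ_[2]) i) =
        C ((w : ℤ) : ℚ_[2]) * PowerSeries.binomialSeries ℚ_[2] c *
          padicLFunctionMinusBranchMult f (1 : ℚ_[2]) i := by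
  obtain ⟨hNM, hM⟩ := level_eq_two_mul_of_dvd_of_not_four_dvd (hf.dvd_level_of_split hsp)
    (not_four_dvd_level_of_split hsp hf)
  have hap : cuspCoeff f 2 = ((1 : ℤ) : ℂ) := by
    rw [Int.cast_one]; exact (hf.cuspCoeff_eq_one_and_sq_of_split hsp).1
  have h := exists_subst_padicLFunctionMinusBranchMult_eq (p := 2) hf.1 hf.coeffField_eq_bot hNM hM hap
    (by norm_num) (torsionOrder_two_dvd i)
  simpa only [Int.cast_one] using h

/-- **FE of the odd branches at a NON-SPLIT multiplicative `2`** (`a₂(f) = −1`, the signed one-term measure):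
`∃ w = ±1, c ∈ ℤ₂`, `L⁻_2(f, −1, ω^i, ι(T)) = w · (1+T)^c · L⁻_2(f, −1, ω^i, T)`.
[cite: MazurTateTeitelbaum1986Invent, §I.17] [cite: Knapp1993, Thm. 9.27(b)] -/
theorem exists_subst_padicLFunctionMinusBranchMult_two_eq_of_nonsplit
    (hmult : V.HasMultiplicativeReductionAtPrime 2) (hns : ¬ V.HasSplitMultiplicativeReductionAtPrime 2)
    (hf : IsNewformOf V f) (i : ℕ) :
    ∃ w : ℤ, w ^ 2 = 1 ∧ ∃ c : ℤ_[2], ∀ {ι : ℚ_[2]⟦X⟧}, (1 + X : ℚ_[2]⟦X⟧) * (ι + 1) = 1 →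
      PowerSeries.subst ι (padicLFunctionMinusBranchMult f (-1 : ℚ_[2]) i) =
        C ((w : ℤ) : ℚ_[2]) * PowerSeries.binomialSeries ℚ_[2] c *
          padicLFunctionMinusBranchMult f (-1 : ℚ_[2]) i := by
  obtain ⟨ha, h2⟩ := hf.cuspCoeff_eq_neg_one_and_dvd_of_nonsplit hmult hns
  obtain ⟨hNM, hM⟩ := level_eq_two_mul_of_dvd_of_not_four_dvd h2
    (not_four_dvd_level_of_nonsplit hf hmult hns)
  have hap : cuspCoeff f 2 = ((-1 : ℤ) : ℂ) := by rw [Int.cast_neg, Int.cast_one]; exact ha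
  have h := exists_subst_padicLFunctionMinusBranchMult_eq (p := 2) hf.1 hf.coeffField_eq_bot hNM hM hap
    (by norm_num) (torsionOrder_two_dvd i)
  simpa only [Int.cast_neg, Int.cast_one] using h

end FE

/-! ## §2 Ideal forms: in `ℚ₂⟦T⟧`, and in `Λ = ℤ₂⟦T⟧` for integral multiples -/

section Ideal

variable {V : WeierstrassCurve ℚ} {N : ℕ} [NeZero N] {f : CuspForm (Gamma0 N) 2}

/-- **`(L⁻_2(T^ι)) = (L⁻_2)` in `ℚ₂⟦T⟧`** for the odd branches at a split multiplicative `2` (unit sign,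
unit multiplier; `span_singleton_subst_eq_of_subst_eq`). [cite: GreenbergLNM1716, §1 (p. 68)]
[cite: MazurTateTeitelbaum1986Invent, §I.17] -/
theorem span_singleton_subst_padicLFunctionMinusBranchMult_two_eq_of_split
    (hsp : V.HasSplitMultiplicativeReductionAtPrime 2) (hf : IsNewformOf V f) (i : ℕ) :
    Ideal.span {(padicLFunctionMinusBranchMult f (1 : ℚ_[2]) i).subst (invOnePlusSubOne : ℚ_[2]⟦X⟧)} =
      Ideal.span {padicLFunctionMinusBranchMult f (1 : ℚ_[2]) i} := by
  obtain ⟨w, hw, c, hFE⟩ := exists_subst_padicLFunctionMinusBranchMult_two_eq_of_split hsp hf i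
  have hw' : w = 1 ∨ w = -1 := mul_self_eq_one_iff.mp (by rw [← sq]; exact hw)
  have hwu : IsUnit ((w : ℤ) : ℚ_[2]) := by
    rcases hw' with rfl | rfl
    · rw [Int.cast_one]; exact isUnit_one
    · rw [Int.cast_neg, Int.cast_one]; exact isUnit_one.neg
  exact span_singleton_subst_eq_of_subst_eq hwu (isUnit_binomialSeries' ℚ_[2] c)
    (hFE one_add_X_mul_invOnePlusSubOne_add_one)

/-- **`(b(T^ι)) = (b)` in `Λ = ℤ₂⟦T⟧` for every integral multiple `b` of an odd branch at a SPLIT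
multiplicative `2`** (`b^ℚ = C t · L⁻_2(f, 1, ω^i, T)`, e.g. `t = 2^m`): the functional equation descended
to `Λ` (`IwasawaAlgebra.span_singleton_subst_eq_of_iwasawaToPowerSeries_eq`, Burungale–Skinner 2023 Prop.
2.2 proof). [cite: MazurTateTeitelbaum1986Invent, §I.17] [cite: BurungaleSkinner2023, Prop. 2.2 (proof)]
[cite: GreenbergLNM1716, §1 (p. 68)] -/
theorem _root_.Literature.NumberTheory.EllipticCurves.IwasawaAlgebra.span_singleton_subst_eq_of_eq_oddBranchMult_two_of_split
    (hsp : V.HasSplitMultiplicativeReductionAtPrime 2) (hf : IsNewformOf V f) {i : ℕ}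
    {b : IwasawaAlgebra 2} {t : ℚ_[2]}
    (hb : iwasawaToPowerSeries 2 b = C t * padicLFunctionMinusBranchMult f (1 : ℚ_[2]) i) :
    Ideal.span {b.subst (invOnePlusSubOne : ℤ_[2]⟦X⟧)} = Ideal.span {b} := by
  obtain ⟨w, hw, c, hFE⟩ := exists_subst_padicLFunctionMinusBranchMult_two_eq_of_split hsp hf i
  exact IwasawaAlgebra.span_singleton_subst_eq_of_iwasawaToPowerSeries_eq hw
    (hFE one_add_X_mul_invOnePlusSubOne_add_one) hb

/-- **`(b(T^ι)) = (b)` in `Λ = ℤ₂⟦T⟧` for every integral multiple `b` of an odd branch at a NON-SPLIT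
multiplicative `2`** (`b^ℚ = C t · L⁻_2(f, −1, ω^i, T)`). [cite: MazurTateTeitelbaum1986Invent, §I.17]
[cite: BurungaleSkinner2023, Prop. 2.2 (proof)] -/
theorem _root_.Literature.NumberTheory.EllipticCurves.IwasawaAlgebra.span_singleton_subst_eq_of_eq_oddBranchMult_two_of_nonsplit
    (hmult : V.HasMultiplicativeReductionAtPrime 2) (hns : ¬ V.HasSplitMultiplicativeReductionAtPrime 2)
    (hf : IsNewformOf V f) {i : ℕ} {b : IwasawaAlgebra 2} {t : ℚ_[2]}
    (hb : iwasawaToPowerSeries 2 b = C t * padicLFunctionMinusBranchMult f (-1 : ℚ_[2]) i) :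
    Ideal.span {b.subst (invOnePlusSubOne : ℤ_[2]⟦X⟧)} = Ideal.span {b} := by
  obtain ⟨w, hw, c, hFE⟩ := exists_subst_padicLFunctionMinusBranchMult_two_eq_of_nonsplit hmult hns hf i
  exact IwasawaAlgebra.span_singleton_subst_eq_of_iwasawaToPowerSeries_eq hw
    (hFE one_add_X_mul_invOnePlusSubOne_add_one) hb

/-- The same through the NAMED involution `IwasawaAlgebra.invol 2` and `Ideal.map` (the spelling of the
addL2x doors): **`ι((b)) = (b)`** for every integral multiple `b` of an odd branch at a split multiplicative
`2`. [cite: MazurTateTeitelbaum1986Invent, §I.17] [cite: GreenbergLNM1716, §1 (p. 68)] -/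
theorem map_invol_span_eq_of_eq_oddBranchMult_two_of_split
    (hsp : V.HasSplitMultiplicativeReductionAtPrime 2) (hf : IsNewformOf V f) {i : ℕ}
    {b : IwasawaAlgebra 2} {t : ℚ_[2]}
    (hb : iwasawaToPowerSeries 2 b = C t * padicLFunctionMinusBranchMult f (1 : ℚ_[2]) i) :
    (Ideal.span {b}).map (IwasawaAlgebra.invol 2).toRingHom = Ideal.span {b} := by
  rw [Ideal.map_span, Set.image_singleton]
  change Ideal.span {IwasawaAlgebra.invol 2 b} = Ideal.span {b}
  rw [Invol.invol_eq_subst_invOnePlusSubOne]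
  exact IwasawaAlgebra.span_singleton_subst_eq_of_eq_oddBranchMult_two_of_split hsp hf hb

/-- Non-split twin: **`ι((b)) = (b)`** for every integral multiple `b` of an odd branch
`L⁻_2(f, −1, ω^i, T)` at a non-split multiplicative `2`. [cite: MazurTateTeitelbaum1986Invent, §I.17] -/
theorem map_invol_span_eq_of_eq_oddBranchMult_two_of_nonsplit
    (hmult : V.HasMultiplicativeReductionAtPrime 2) (hns : ¬ V.HasSplitMultiplicativeReductionAtPrime 2)
    (hf : IsNewformOf V f) {i : ℕ} {b : IwasawaAlgebra 2} {t : ℚ_[2]}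
    (hb : iwasawaToPowerSeries 2 b = C t * padicLFunctionMinusBranchMult f (-1 : ℚ_[2]) i) :
    (Ideal.span {b}).map (IwasawaAlgebra.invol 2).toRingHom = Ideal.span {b} := by
  rw [Ideal.map_span, Set.image_singleton]
  change Ideal.span {IwasawaAlgebra.invol 2 b} = Ideal.span {b}
  rw [Invol.invol_eq_subst_invOnePlusSubOne]
  exact IwasawaAlgebra.span_singleton_subst_eq_of_eq_oddBranchMult_two_of_nonsplit hmult hns hf hb

end Ideal

end Summit.BirchSwinnertonDyer.BirchSwinnertonDyer.Theorems.MultOddBranchFE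

end
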